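import Summits.ABC.IUTFork.Repair.CandInternal11GapWindow
import Summits.ABC.IUTFork.Cor312LicenceRealSharpTame
import HarnessLib

/-!
# IUT REPAIR branch → R-H (D-0079 «local-height» programme), item (α) GENUINE half, TAME STRATUM: «I06⋆ cell (slack ≥ 0) ⇒ licence cell»
# AT THE GENUINE print-normalised sharp setting over a unique tamely ramified bad place, at EVERY q-depth `m`

PROOF-ONLY file (D-0012: 0 definitions, 0 `Prop` facts; abc-iut cell, rung LADDER-ABC:A2.RP → A2.RESCUE-H; seat abc-iut-rp-h3 gen 4; split of
the D-0079 (5) prover item with abc-iut-rp-m4 13:31:25Z: (α) = this lineage). TAKES NO SIDE on [IUTchIII] Cor. 3.12 or on any author; every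
statement is about OUR typed objects (abc-iut-c312-7's `Thm311.Real.settingPrVolSharp`, abc-iut-c312-5's `logShellsDH` with Dupuy–Hilado's
(Ind2) = ALL shell-preserving bicontinuous lattice automorphisms `Real.ismDH`, the SHARP idele boxes); typed ≠ proved; instantiated ≠ endorsed.

WHAT. The interface half (`CandInternal11GapWindow`, p449188) re-cut abc-iut-rp-d2's «I06⋆ ⇒ Licence» cell by cell and window by window. THIS
file decides the GENUINE cell on the TAME stratum of the I06STAR-TABLE, BY NAME from abc-iut-w4-d087's `Cor312LicenceRealSharpTame`
(`qRegion_subset_thetaHull_settingPrVolSharp_of_tame`, `licence_settingPrVolSharp_of_tame`, `statement_settingPrVolSharp_of_tame` — the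
(Ind2)-REACH at a tame place from abc-iut-w5-d180's transitivity on primitive lattice vectors). Data: an odd prime `p₀` carrying a UNIQUE
place `x₀` of `F`, TAME (`e := e(x₀|p₀) ≤ p₀ − 2`), a norm uniformizer `ϖ`, the idele depths in `ϖ`-exponents `‖t_{q,x₀}‖ = ‖ϖ‖^{n_q}`,
`‖t_{Θ,i+1,x₀}‖ = ‖ϖ‖^{b_i}`. At a tame place the log-shell is `I_{x₀} = p₀⁻¹·log_p(𝒪^×) = ϖ^{1−e}·𝒪_{x₀}` (abc-iut-w5-d216
`logUnits_eq_closedBall_of_tame`), so its index over `𝒪_{x₀}` in `ϖ`-units is `d_{x₀} = e − 1`, and the I06⋆ CELL «`t_q·𝒪 ⊆ t_{Θ,j}·I`» at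
`(j, x₀)` reads, in exponents, **`b_i + 1 − e ≤ n_q`** — the table's `slack_j ≥ 0`:

* §1 `tame_reach_of_starCell` — the I06⋆ cell in exponents IMPLIES abc-iut-w4-d087's reach inequality `(1 − e)(i+1) + e·k_i + 1 ≤ n_q`
  (`e·k_i + 1 ≤ b_i`): the I06⋆ container `t_Θ·I` asks MORE than the (Ind2)-reach needs — pure integer arithmetic.
* §2 **`qRegion_subset_thetaHull_settingPrVolSharp_of_starCell_tame`** — I06⋆ CELL (exponent form) ⇒ LICENCE CELL `qRegion ⊆ ⁿ˒°𝒰` at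
  `(i+1, p₀)` of `settingPrVolSharp`, for every column / context / archimedean binder.
* §3 the HONESTLY `j²`-SCALED profile at ANY `q`-depth `m ≥ 1` (`‖t_q‖ = ‖ϖ‖^m`, `‖t_{Θ,j}‖ = ‖ϖ‖^{j²m}`, Dupuy–Hilado (3.4)):
  **`qRegion_subset_thetaHull_settingPrVolSharp_of_slack_tame`** — `(j² − 1)·m ≤ e − 1` (the table's `slack_j = d_v − (j²−1)·ord(q) ≥ 0` in
  `ϖ`-units) ⇒ licence cell at `(j, p₀)` (content `k_i := (j²m − 1) div e`); and the window/global forms **`licence_settingPrVolSharp_of_slack_tame`**,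
  **`statement_settingPrVolSharp_of_slack_tame`** — all bad places over `p₀`, ideles units off `S`, `(ℓ⋆² − 1)·m ≤ e − 1` ⇒ the typed (xi-f)
  Licence and the typed [IUTchIII] Cor. 3.12 Statement HOLD at the genuine sharp setting (at `m = 1` this is w4-d087's `ℓ⋆² ≤ e` window; his
  sharper `ℓ⋆ ≤ e` window shows the I06⋆ cell is SUFFICIENT, not necessary, for the licence cell).

READING for R-H (neutral): on the tame stratum the table's implication column «slack ≥ 0 ⇒ licence cell» has a kernel decider at every depth,
and the converse fails (w4-d087's sharper window): I06⋆ is STRONGER than what the hull needs there. The unramified-odd stratum is decided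
negatively for I06⋆ by abc-iut-rp-d2 (`CandInternal2Real`) and for the licence by abc-iut-C-cert-2 (case A); the wild stratum (`v | 2`, `v | l`,
`e > p − 2`) and primes with several places are NOT treated here (multi-reach `Cor312LicenceOfMultiReach` is the vehicle; the shell index there is
not `e − 1`). [cite: DupuyHilado2025, §3.4, §3.9, §4.9] [cite: WeilBNT1967, Ch. II §2, Th. 1] [cite: ScholzeStix2018, §2.2 pp. 9–10]
[claim: Mochizuki2012, status: disputed] for every [IUTchIII]/[IUTchIV] locution. Axioms: standard.
-/

noncomputable section

open Metric Set Function NumberField IsDedekindDomain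
open scoped Pointwise

namespace Summit.ABC.IUTFork.Repair.CandInternal11GapGenuineTame

open Thm311 Thm311.Real Cor312 Cor312Vol Literature.IUT.LogThetaLattice Literature.IUT.LogVolume
open Literature.NumberTheory.NumberFields Literature.NumberTheory.GaloisRepresentations.Ultrametric

/-! ## §1. Arithmetic: the I06⋆ cell in `ϖ`-exponents implies the tame (Ind2)-reach inequality -/

/-- **I06⋆ cell ⇒ reach.** With `1 ≤ e`, `e·k + 1 ≤ b` (the content of the Θ-idele) and the I06⋆ cell `b + 1 − e ≤ n_q` (`t_q ∈ t_Θ·ϖ^{1−e}𝒪`):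
abc-iut-w4-d087's reach inequality `(1 − e)·(i+1) + e·k + 1 ≤ n_q` at every label index `i`. [folklore] -/
theorem tame_reach_of_starCell {e k b nq : ℤ} (he1 : 1 ≤ e) (hk1 : e * k + 1 ≤ b) (i : ℕ) (hstar : b + 1 - e ≤ nq) :
    (1 - e) * ((i : ℤ) + 1) + e * k + 1 ≤ nq := by
  have hi : (0 : ℤ) ≤ (i : ℤ) := Int.natCast_nonneg i
  have hprod : 0 ≤ (e - 1) * (i : ℤ) := mul_nonneg (by linarith) hi
  nlinarith

/-- Euclidean bookkeeping for the honest profile: with `e ≥ 1`, the content `k := (a − 1) / e` satisfies `e·k + 1 ≤ a ≤ e·k + e`.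
[folklore] -/
theorem content_bounds {e : ℤ} (he1 : 1 ≤ e) (a : ℤ) :
    e * ((a - 1) / e) + 1 ≤ a ∧ a ≤ e * ((a - 1) / e) + e := by
  have he0 : 0 < e := by linarith
  have h1 := Int.mul_ediv_add_emod (a - 1) e -- `e * ((a - 1) / e) + (a - 1) % e = a - 1`
  have h2 := Int.emod_nonneg (a - 1) he0.ne'
  have h3 := Int.emod_lt_of_pos (a - 1) he0
  constructor <;> linarith

/-! ## §2. The genuine cell over a unique tamely ramified bad place -/

section Assembled

variable {F : Type} [Field F] [NumberField F] (X : PilotData F) {logv : PadicLogs F} (hlog : LogvAnalytic logv)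
  (M : Type) [Field M] [NumberField M]
  (archPk : ∀ (j : (thetaIndex X).Label) (vQ : (thetaIndex X).VQ), Set ((logShellsDH X logv).Packet j vQ))
  (archSub : ∀ (j : (thetaIndex X).Label) (v : (thetaIndex X).V),
    Set ((logShellsDH X logv).Packet j ((thetaIndex X).over v)))
  (Ψ : ℤ → ∀ v : (thetaIndex X).V, v ∈ (thetaIndex X).Vbad → Set ((logShellsDH X logv).StarPacket v))
  (act : ℤ → ∀ v : (thetaIndex X).V, v ∈ (thetaIndex X).Vbad →
    (logShellsDH X logv).StarPacket v → Module.End ℚ ((logShellsDH X logv).StarPacket v))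
  (Mmod : ℤ → ∀ j : (thetaIndex X).LabelStar, Set ((logShellsDH X logv).GlobalPacket j.1))
  (region : ℤ → ∀ j : (thetaIndex X).LabelStar, FinDivisor M → ∀ vQ : (thetaIndex X).VQ,
    Set ((logShellsDH X logv).Packet j.1 vQ))
  (n : ℤ) {HT : Type} {LogLink : HT → HT → Type} {IsFull : ∀ {s t : HT}, LogLink s t → Prop}
  (lat : LGPGaussianLogThetaLattice LogLink IsFull)
  {Frd : Type} {IsoF : Frd → Frd → Type} {Ob : Frd → Type} {realify : Frd → Frd} {Strip : Type}
  {IsoS : Strip → Strip → Type} {Mv : ∀ v : (thetaIndex X).V, v ∈ (thetaIndex X).Vbad → Type}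
  [∀ v h, Monoid (Mv v h)]
  (sig : GlobalLGPFrobenioidSignature (thetaIndex X).lstar (thetaIndex X).V (· ∈ (thetaIndex X).Vbad)
    Frd IsoF Ob realify Strip IsoS Mv)
  (split : SplittingMonoids Mv) {ObΔ : Type} {N : ∀ v : (thetaIndex X).V, v ∈ (thetaIndex X).Vbad → Type}
  [∀ v h, Monoid (N v h)] (qData : QPilotData ObΔ N)
  (tq : ∀ (pp : Nat.Primes) (x : (thetaIndex X).Fibre (.inr pp)),
    haveI : Fact (pp : ℕ).Prime := ⟨pp.2⟩; kOf X pp.1 x)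
  (t : ∀ (pp : Nat.Primes) (_ : Fin X.lstar) (x : (thetaIndex X).Fibre (.inr pp)),
    haveI : Fact (pp : ℕ).Prime := ⟨pp.2⟩; kOf X pp.1 x)
  (htq0 : ∀ pp x, tq pp x ≠ 0)
  (htq1 : ∀ (pp : Nat.Primes) (x : (thetaIndex X).Fibre (.inr pp)),
    haveI : Fact (pp : ℕ).Prime := ⟨pp.2⟩; placeOf X pp.1 x ∉ X.S → ‖tq pp x‖ = 1)
  (ht0 : ∀ pp i x, t pp i x ≠ 0)
  -- the tamely ramified place `⟨.inr v₀, hv₀⟩`, UNIQUE over `p₀`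
  (pp₀ : Nat.Primes) [Fact (pp₀ : ℕ).Prime] (v₀ : HeightOneSpectrum (𝓞 F))
  (hv₀ : (thetaIndex X).over (.inr v₀) = .inr pp₀)
  (huniq : ∀ x : (thetaIndex X).Fibre (.inr pp₀), x = ⟨.inr v₀, hv₀⟩)
  (hp2 : 2 < (pp₀ : ℕ)) (he : v₀.asIdeal.ramificationIdx ℤ ≤ (pp₀ : ℕ) - 2)
  {ϖ : (kOf X pp₀.1 ⟨.inr v₀, hv₀⟩)ˣ} (hϖ : IsUniformizer ϖ)

include hv₀ in
/-- `1 ≤ e(x₀|p₀)` for a place `x₀` in the fibre over `p₀`. [folklore] -/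
theorem one_le_ramificationIdx : 1 ≤ (v₀.asIdeal.ramificationIdx ℤ : ℤ) := by
  have hv : ((pp₀ : ℕ) : 𝓞 F) ∈ v₀.asIdeal := natCast_mem_placeOf X pp₀.1 ⟨.inr v₀, hv₀⟩
  have h : 0 < absRamificationIdx pp₀.1 (RescaledCompletion F pp₀.1 v₀ hv) := absRamificationIdx_pos _ _
  rw [absRamificationIdx_rescaledCompletion F pp₀.1 v₀ hv] at h
  exact_mod_cast h

include hlog huniq hp2 he hϖ ht0

/-- **I06⋆ CELL ⇒ LICENCE CELL AT THE GENUINE SHARP SETTING (tame, unique place), general depths.** With `‖t_{q,x₀}‖ = ‖ϖ‖^{n_q}`,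
`‖t_{Θ,i+1,x₀}‖ = ‖ϖ‖^{b_i}` of content `k_i` (`e·k_i + 1 ≤ b_i ≤ e·k_i + e`): the I06⋆ cell `b_i + 1 − e ≤ n_q` («`t_q·𝒪 ⊆ t_{Θ,i+1}·I_{x₀}`»,
`I_{x₀} = ϖ^{1−e}𝒪`) gives `qRegion (i+1) p₀ ⊆ thetaHull (i+1) p₀` (abc-iut-w4-d087 `qRegion_subset_thetaHull_settingPrVolSharp_of_tame` with §1).
[cite: DupuyHilado2025, §3.9, §4.9] [cite: WeilBNT1967, Ch. II §2, Th. 1] [claim: Mochizuki2012, status: disputed] -/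
theorem qRegion_subset_thetaHull_settingPrVolSharp_of_starCell_tame
    (nq : ℤ) (hnq : ‖tq pp₀ ⟨.inr v₀, hv₀⟩‖ = ‖(ϖ : kOf X pp₀.1 ⟨.inr v₀, hv₀⟩)‖ ^ nq)
    (b k : Fin X.lstar → ℤ) (hb : ∀ i, ‖t pp₀ i ⟨.inr v₀, hv₀⟩‖ = ‖(ϖ : kOf X pp₀.1 ⟨.inr v₀, hv₀⟩)‖ ^ b i)
    (hk : ∀ i, (v₀.asIdeal.ramificationIdx ℤ : ℤ) * k i + 1 ≤ b i ∧
      b i ≤ (v₀.asIdeal.ramificationIdx ℤ : ℤ) * k i + v₀.asIdeal.ramificationIdx ℤ)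
    (i : Fin (thetaIndex X).lstar) (hstar : b i + 1 - (v₀.asIdeal.ramificationIdx ℤ : ℤ) ≤ nq) :
    (settingPrVolSharp X hlog M archPk archSub Ψ act Mmod region n lat sig split qData tq t htq0 htq1).qRegion
        (Setting.labelSucc i) (.inr pp₀) ⊆
      (settingPrVolSharp X hlog M archPk archSub Ψ act Mmod region n lat sig split qData tq t htq0 htq1).thetaHull
        (Setting.labelSucc i) (.inr pp₀) :=
  qRegion_subset_thetaHull_settingPrVolSharp_of_tame X hlog M archPk archSub Ψ act Mmod region n lat sig split qData tq t htq0 htq1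
    ht0 pp₀ v₀ hv₀ huniq hp2 he hϖ nq hnq b k hb hk i
    (tame_reach_of_starCell (one_le_ramificationIdx X pp₀ v₀ hv₀) (hk i).1 i hstar)

/-! ## §3. The honestly `j²`-scaled profile at every `q`-depth `m`: the table's «slack ≥ 0 ⇒ licence» -/

/-- **SLACK ≥ 0 ⇒ LICENCE CELL, honest profile, any depth.** With `‖t_{q,x₀}‖ = ‖ϖ‖^m` (any `m ∈ ℤ`) and `‖t_{Θ,i+1,x₀}‖ = ‖ϖ‖^{(i+1)²m}`
(Dupuy–Hilado (3.4)): if `((i+1)² − 1)·m ≤ e − 1` — the I06STAR-TABLE's `slack_{i+1}(x₀) ≥ 0` with the tame shell index `d_{x₀} = e − 1` in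
`ϖ`-units — then `qRegion (i+1) p₀ ⊆ thetaHull (i+1) p₀` at the genuine sharp setting. [cite: DupuyHilado2025, §3.4, §3.9, §4.9]
[claim: Mochizuki2012, status: disputed] -/
theorem qRegion_subset_thetaHull_settingPrVolSharp_of_slack_tame (m : ℤ)
    (hnq : ‖tq pp₀ ⟨.inr v₀, hv₀⟩‖ = ‖(ϖ : kOf X pp₀.1 ⟨.inr v₀, hv₀⟩)‖ ^ m)
    (hbm : ∀ i : Fin X.lstar, ‖t pp₀ i ⟨.inr v₀, hv₀⟩‖ = ‖(ϖ : kOf X pp₀.1 ⟨.inr v₀, hv₀⟩)‖ ^ ((((i : ℕ) : ℤ) + 1) ^ 2 * m))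
    (i : Fin (thetaIndex X).lstar) (hslack : ((((i : ℕ) : ℤ) + 1) ^ 2 - 1) * m ≤ (v₀.asIdeal.ramificationIdx ℤ : ℤ) - 1) :
    (settingPrVolSharp X hlog M archPk archSub Ψ act Mmod region n lat sig split qData tq t htq0 htq1).qRegion
        (Setting.labelSucc i) (.inr pp₀) ⊆
      (settingPrVolSharp X hlog M archPk archSub Ψ act Mmod region n lat sig split qData tq t htq0 htq1).thetaHull
        (Setting.labelSucc i) (.inr pp₀) := by
  have he1 := one_le_ramificationIdx X pp₀ v₀ hv₀
  refine qRegion_subset_thetaHull_settingPrVolSharp_of_starCell_tame X hlog M archPk archSub Ψ act Mmod region n lat sig split qData tq t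
    htq0 htq1 ht0 pp₀ v₀ hv₀ huniq hp2 he hϖ m hnq (fun i' => (((i' : ℕ) : ℤ) + 1) ^ 2 * m)
    (fun i' => ((((i' : ℕ) : ℤ) + 1) ^ 2 * m - 1) / (v₀.asIdeal.ramificationIdx ℤ : ℤ)) hbm
    (fun i' => content_bounds he1 _) i ?_
  have hsq : ((((i : ℕ) : ℤ) + 1) ^ 2 * m) = ((((i : ℕ) : ℤ) + 1) ^ 2 - 1) * m + m := by ring
  rw [hsq]
  linarith

variable (hS : ∀ (pp : Nat.Primes) (x : (thetaIndex X).Fibre (.inr pp)),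
    haveI : Fact (pp : ℕ).Prime := ⟨pp.2⟩; placeOf X pp.1 x ∈ X.S → pp = pp₀)
  (ht1 : ∀ (pp : Nat.Primes) (i : Fin X.lstar) (x : (thetaIndex X).Fibre (.inr pp)),
    haveI : Fact (pp : ℕ).Prime := ⟨pp.2⟩; placeOf X pp.1 x ∉ X.S → ‖t pp i x‖ = 1)

include hS ht1

/-- **SLACK ≥ 0 AT THE TOP LABEL ⇒ THE TYPED (xi-f) LICENCE**, honest profile, any depth: all bad places over the unique tame `p₀`, ideles units off
`S`, `(ℓ⋆² − 1)·m ≤ e − 1` (the top label `ℓ⋆` has the least slack) ⇒ `Thm311ToCor312.Licence (settingPrVolSharp …)`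
(abc-iut-w4-d087 `licence_settingPrVolSharp_of_tame`). [cite: DupuyHilado2025, §3.4, §3.9, §4.9] [claim: Mochizuki2012, status: disputed] -/
theorem licence_settingPrVolSharp_of_slack_tame (m : ℤ) (hm : 1 ≤ m)
    (hnq : ‖tq pp₀ ⟨.inr v₀, hv₀⟩‖ = ‖(ϖ : kOf X pp₀.1 ⟨.inr v₀, hv₀⟩)‖ ^ m)
    (hbm : ∀ i : Fin X.lstar, ‖t pp₀ i ⟨.inr v₀, hv₀⟩‖ = ‖(ϖ : kOf X pp₀.1 ⟨.inr v₀, hv₀⟩)‖ ^ ((((i : ℕ) : ℤ) + 1) ^ 2 * m))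
    (hslack : (((X.lstar : ℕ) : ℤ) ^ 2 - 1) * m ≤ (v₀.asIdeal.ramificationIdx ℤ : ℤ) - 1) :
    Thm311ToCor312.Licence (settingPrVolSharp X hlog M archPk archSub Ψ act Mmod region n lat sig split qData tq t htq0 htq1) := by
  have he1 := one_le_ramificationIdx X pp₀ v₀ hv₀
  refine licence_settingPrVolSharp_of_tame X hlog M archPk archSub Ψ act Mmod region n lat sig split qData tq t htq0 htq1 ht0 pp₀ v₀ hv₀
    huniq hp2 he hϖ m hnq (fun i' => (((i' : ℕ) : ℤ) + 1) ^ 2 * m)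
    (fun i' => ((((i' : ℕ) : ℤ) + 1) ^ 2 * m - 1) / (v₀.asIdeal.ramificationIdx ℤ : ℤ)) hbm
    (fun i' => content_bounds he1 _) (fun i => ?_) hS ht1
  refine tame_reach_of_starCell he1 (content_bounds he1 _).1 i ?_
  -- the slack at the label `i+1 ≤ ℓ⋆` is at least the slack at `ℓ⋆`
  have hi : ((i : ℕ) : ℤ) + 1 ≤ ((X.lstar : ℕ) : ℤ) := by
    have h := i.2
    have h' : (i : ℕ) + 1 ≤ X.lstar := h
    exact_mod_cast h'
  have hi0 : (0 : ℤ) ≤ ((i : ℕ) : ℤ) + 1 := by positivity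
  have hsq_le : (((i : ℕ) : ℤ) + 1) ^ 2 ≤ ((X.lstar : ℕ) : ℤ) ^ 2 := pow_le_pow_left₀ hi0 hi 2
  have hm0 : 0 ≤ m := by linarith
  have hmono : ((((i : ℕ) : ℤ) + 1) ^ 2 - 1) * m ≤ (((X.lstar : ℕ) : ℤ) ^ 2 - 1) * m :=
    mul_le_mul_of_nonneg_right (by linarith) hm0
  have hsq : ((((i : ℕ) : ℤ) + 1) ^ 2 * m) = ((((i : ℕ) : ℤ) + 1) ^ 2 - 1) * m + m := by ring
  rw [hsq]
  linarith

/-- **… hence the typed [IUTchIII] Cor. 3.12 `Statement` HOLDS at that genuine sharp setting** (abc-iut-w4-d087 `statement_settingPrVolSharp_of_tame`: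
the licence above plus abc-iut-c312-7's `bridgeHyps_settingPrVolSharp_of_ideles`). A POSITIVE row-window of the table decided by slack alone — under
DH's (Ind2) as lattice automorphisms; nothing about initial Θ-data. [cite: DupuyHilado2025, §3.4, §3.9, §4.9] [claim: Mochizuki2012, status: disputed] -/
theorem statement_settingPrVolSharp_of_slack_tame (m : ℤ) (hm : 1 ≤ m)
    (hnq : ‖tq pp₀ ⟨.inr v₀, hv₀⟩‖ = ‖(ϖ : kOf X pp₀.1 ⟨.inr v₀, hv₀⟩)‖ ^ m)
    (hbm : ∀ i : Fin X.lstar, ‖t pp₀ i ⟨.inr v₀, hv₀⟩‖ = ‖(ϖ : kOf X pp₀.1 ⟨.inr v₀, hv₀⟩)‖ ^ ((((i : ℕ) : ℤ) + 1) ^ 2 * m))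
    (hslack : (((X.lstar : ℕ) : ℤ) ^ 2 - 1) * m ≤ (v₀.asIdeal.ramificationIdx ℤ : ℤ) - 1) :
    (settingPrVolSharp X hlog M archPk archSub Ψ act Mmod region n lat sig split qData tq t htq0 htq1).Statement :=
  Thm311ToCor312.statement_of_licence
    (bridgeHyps_settingPrVolSharp_of_ideles X hlog M archPk archSub Ψ act Mmod region n lat sig split qData t tq ht0 ht1 htq0 htq1)
    (licence_settingPrVolSharp_of_slack_tame X hlog M archPk archSub Ψ act Mmod region n lat sig split qData tq t htq0 htq1 ht0 pp₀ v₀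
      hv₀ huniq hp2 he hϖ hS ht1 m hm hnq hbm hslack)

end Assembled

end Summit.ABC.IUTFork.Repair.CandInternal11GapGenuineTame

end
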